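import Literature.Barriers.CriticalPhenomena.WeaklySAWFourDimLogCorrectionsProofs
import Literature.Barriers.CriticalPhenomena.LaceExpansionIsingRandomWalkBound
import HarnessLib

/-!
# Return probabilities of simple random walk on `ℤ^d` and transience in `d ≥ 3`

Support file for the `d > 2` clause of `Literature.Barriers.CriticalPhenomena.CTWSAW.BBS2015_lemA1`
(Bauerschmidt–Brydges–Slade 2015, Lemma A.1: "`E(I(T)) ≤ 2TC₀(0)`, and the Green function
`C₀(x)` is finite for `d > 2` (the estimate can be done as in the discrete case, see, e.g., [BS95])").

In the jump-chain representation, `C₀(0) = ∫₀^∞ P(X(T) = 0) dT = (2d)⁻¹ Σₙ pₙ(0)`, where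
`pₙ(x) = #{n-step walks 0 → x}/(2d)ⁿ` is the `n`-step transition probability of the discrete
simple random walk. This file proves the discrete input — **transience of simple random walk on
`ℤ^d`, `d ≥ 3`: `Σₙ pₙ(0) < ∞`** — by the Fourier method already used in the tree for the
spread-out walk (`SpreadOutIsing.summable_convPow`, `LaceExpansionIsingRandomWalkBound.lean`):
* `card_finsetWalkLength_reverse`, `card_finsetWalkLength_succ_last` (last-step recursion) and
  `card_succ_eq_sum_steps` (`N_{n+1}(x) = Σⱼ (Nₙ(x+eⱼ) + Nₙ(x-eⱼ))` on `ℤ^d`);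
* `prob_eq_integral`: `pₙ(x) = (2π)^{-d} ∫_{[-π,π]^d} D̂(k)ⁿ cos(k·x) dk`, `D̂(k) = d⁻¹ Σⱼ cos kⱼ`;
* `one_sub_symbol`: `1 - D̂ = ε/d` (`ε = dispersion`), so `|Σ_{n<M} D̂ⁿ| ≤ 2/(1-D̂) = 2d/ε` and
  `sum_range_prob_zero_le`: `Σ_{n<M} pₙ(0) ≤ (2π)^{-d} ∫ 2d/ε(k) dk`, finite for `d ≥ 3`
  (`integrable_indicator_inv_dispersion`);
* `summable_prob_zero` (`d ≥ 3`), `tsum_prob_zero_le`.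

## References
* R. Bauerschmidt, D. C. Brydges, G. Slade, CMP 337 (2015), Appendix A, Lemma A.1 (proof).
  [BauerschmidtBrydgesSlade2015LogCorr]
* G. F. Lawler, V. Limic, *Random Walk: A Modern Introduction* (2010), §4.1 (Green function via the
  characteristic function; transience for `d ≥ 3`).
-/

noncomputable section

open MeasureTheory Set Filter Finset Literature.Probability.LatticeModels
open Literature.Barriers.CriticalPhenomena.SpreadOutIsing (integral_cube_cos_kdot kdot_sub
  kdot_single_right continuous_kdot_left abs_geom_sum_le cube_eq_brillouin)
open Literature.Probability.Percolation (kdot_add)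
open scoped BigOperators Real

namespace Literature.Barriers.CriticalPhenomena.CTWSAW

variable {d : ℕ}

/-! ### Counting walks: reversal and the last-step recursion -/

section Generic

variable {V : Type*} [DecidableEq V] (G : SimpleGraph V) [G.LocallyFinite]

/-- Reversal is a bijection between `n`-step walks `u → v` and `v → u`. [folklore] -/
theorem card_finsetWalkLength_reverse (n : ℕ) (u v : V) :
    (G.finsetWalkLength n u v).card = (G.finsetWalkLength n v u).card := by
  refine Finset.card_bij' (fun p _ => p.reverse) (fun p _ => p.reverse) ?_ ?_ ?_ ?_
  · intro p hp
    rw [SimpleGraph.mem_finsetWalkLength_iff] at hp ⊢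
    rw [SimpleGraph.Walk.length_reverse, hp]
  · intro p hp
    rw [SimpleGraph.mem_finsetWalkLength_iff] at hp ⊢
    rw [SimpleGraph.Walk.length_reverse, hp]
  · intro p _
    exact SimpleGraph.Walk.reverse_reverse p
  · intro p _
    exact SimpleGraph.Walk.reverse_reverse p

/-- **Last-step decomposition**: the `n+1`-step walks `u → v` are counted by summing the `n`-step
walks from `u` to the neighbours of `v`. [folklore] -/
theorem card_finsetWalkLength_succ_last (n : ℕ) (u v : V) :
    (G.finsetWalkLength (n + 1) u v).card =
      ∑ w ∈ G.neighborFinset v, (G.finsetWalkLength n u w).card := by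
  rw [card_finsetWalkLength_reverse, card_finsetWalkLength_succ]
  exact Finset.sum_congr rfl fun w _ => card_finsetWalkLength_reverse G n w u

end Generic

/-- `N_{n+1}(x) = Σⱼ (Nₙ(x + eⱼ) + Nₙ(x - eⱼ))` for the number `Nₙ(x)` of `n`-step nearest-neighbour
walks `0 → x` on `ℤ^d`. [folklore] -/
theorem card_succ_eq_sum_steps (n : ℕ) (x : Site d) :
    (((zdGraph d).finsetWalkLength (n + 1) (0 : Site d) x).card : ℝ) =
      ∑ j : Fin d, ((((zdGraph d).finsetWalkLength n (0 : Site d) (x + Pi.single j 1)).card : ℝ) +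
        ((zdGraph d).finsetWalkLength n (0 : Site d) (x - Pi.single j 1)).card) := by
  rw [card_finsetWalkLength_succ_last, neighborFinset_zdGraph_eq,
    Finset.sum_image fun p _ q _ h => step_injective x h]
  push_cast
  rw [Fintype.sum_prod_type]
  refine Finset.sum_congr rfl fun j _ => ?_
  rw [Fintype.sum_bool]
  simp

/-! ### The Fourier representation `pₙ(x) = (2π)^{-d} ∫ D̂ⁿ cos(k·x)` -/

/-- The `n`-step transition probability `pₙ(x) = Nₙ(x)/(2d)ⁿ` of simple random walk on `ℤ^d`. -/
local notation3 (prettyPrint := false) "prob[" d ", " n ", " x "]" =>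
  ((((zdGraph d).finsetWalkLength n (0 : Site d) x).card : ℝ) / (2 * (d : ℝ)) ^ n)

/-- The symbol `D̂(k) = d⁻¹ Σⱼ cos kⱼ` of the nearest-neighbour step distribution. -/
local notation3 (prettyPrint := false) "Dhat[" d ", " k "]" =>
  ((∑ j : Fin d, Real.cos ((k : Fin d → ℝ) j)) / (d : ℝ))

/-- `pₙ ≥ 0`. [folklore] -/
theorem prob_nonneg (n : ℕ) (x : Site d) : 0 ≤ prob[d, n, x] := by positivity

/-- `D̂` is continuous. [folklore] -/
theorem continuous_symbol : Continuous fun k : Fin d → ℝ => Dhat[d, k] :=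
  (continuous_finsetSum _ fun j _ => Real.continuous_cos.comp (continuous_apply j)).div_const _

/-- `Σⱼ (cos(k·(x+eⱼ)) + cos(k·(x-eⱼ))) = 2 (Σⱼ cos kⱼ) cos(k·x)`. [folklore] -/
theorem sum_cos_kdot_steps (k : Fin d → ℝ) (x : Site d) :
    ∑ j : Fin d, (Real.cos (kdot k (x + Pi.single j 1)) + Real.cos (kdot k (x - Pi.single j 1))) =
      2 * (∑ j : Fin d, Real.cos (k j)) * Real.cos (kdot k x) := by
  rw [Finset.mul_sum, Finset.sum_mul]
  refine Finset.sum_congr rfl fun j _ => ?_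
  rw [kdot_add, kdot_sub, kdot_single_right, Real.cos_add, Real.cos_sub]
  ring

/-- **Fourier representation of the transition probabilities**:
`pₙ(x) = (2π)^{-d} ∫_{[-π,π]^d} D̂(k)ⁿ cos(k·x) dk` (`d ≥ 1`). [folklore] -/
theorem prob_eq_integral (hd : 1 ≤ d) (n : ℕ) (x : Site d) :
    prob[d, n, x] = ((2 * π) ^ d)⁻¹ * ∫ k in cube d, (Dhat[d, k]) ^ n * Real.cos (kdot k x) := by
  have hπ : ((2 * π) ^ d : ℝ) ≠ 0 := pow_ne_zero _ (by positivity)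
  have hd0 : (d : ℝ) ≠ 0 := by exact_mod_cast (show d ≠ 0 by omega)
  have hint : ∀ (m : ℕ) (y : Site d),
      IntegrableOn (fun k => (Dhat[d, k]) ^ m * Real.cos (kdot k y)) (cube d) volume := fun m y =>
    ContinuousOn.integrableOn_compact (isCompact_univ_pi fun _ => isCompact_Icc)
      ((continuous_symbol.pow m).mul (Real.continuous_cos.comp (continuous_kdot_left y))).continuousOn
  induction n generalizing x with
  | zero =>
    simp only [pow_zero, one_mul, div_one]
    rw [integral_cube_cos_kdot, card_finsetWalkLength_zero]
    by_cases hx : x = 0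
    · subst hx; simp
    · rw [if_neg (Ne.symm hx), if_neg hx]; simp
  | succ n ih =>
    rw [pow_succ, card_succ_eq_sum_steps, Finset.sum_div]
    have hstep : ∀ j : Fin d,
        ((((zdGraph d).finsetWalkLength n (0 : Site d) (x + Pi.single j 1)).card : ℝ) +
          ((zdGraph d).finsetWalkLength n (0 : Site d) (x - Pi.single j 1)).card) /
            ((2 * (d : ℝ)) ^ n * (2 * d)) =
        (prob[d, n, x + Pi.single j 1] + prob[d, n, x - Pi.single j 1]) / (2 * d) := fun j => by
      ring
    simp_rw [hstep, ih, ← Finset.sum_div]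
    -- swap the finite sum and the integral
    have hsum : ∑ j : Fin d,
        ((((2 * π) ^ d)⁻¹ * ∫ k in cube d, (Dhat[d, k]) ^ n * Real.cos (kdot k (x + Pi.single j 1))) +
          (((2 * π) ^ d)⁻¹ * ∫ k in cube d, (Dhat[d, k]) ^ n * Real.cos (kdot k (x - Pi.single j 1)))) =
        ((2 * π) ^ d)⁻¹ * ∫ k in cube d,
          (Dhat[d, k]) ^ n * (2 * (∑ j : Fin d, Real.cos (k j)) * Real.cos (kdot k x)) := by
      simp_rw [← mul_add, ← Finset.mul_sum]
      congr 1
      simp_rw [← integral_add (hint n _) (hint n _)]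
      have hint2 : ∀ j : Fin d, IntegrableOn (fun k : Fin d → ℝ =>
          (Dhat[d, k]) ^ n * Real.cos (kdot k (x + Pi.single j 1)) +
            (Dhat[d, k]) ^ n * Real.cos (kdot k (x - Pi.single j 1))) (cube d) volume := fun j =>
        ContinuousOn.integrableOn_compact (isCompact_univ_pi fun _ => isCompact_Icc)
          (((continuous_symbol.pow n).mul (Real.continuous_cos.comp (continuous_kdot_left _))).add
            ((continuous_symbol.pow n).mul (Real.continuous_cos.comp (continuous_kdot_left _)))).continuousOn
      rw [← integral_finsetSum _ fun j _ => hint2 j]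
      refine integral_congr_ae (ae_of_all _ fun k => ?_)
      simp_rw [← mul_add, ← Finset.mul_sum, sum_cos_kdot_steps]
    rw [hsum, mul_div_assoc, ← integral_div]
    congr 1
    refine integral_congr_ae (ae_of_all _ fun k => ?_)
    beta_reduce
    rw [pow_succ]
    field_simp

/-! ### The infrared bound of the symbol and transience -/

/-- `1 - D̂(k) = ε(k)/d`, `ε(k) = Σⱼ (1 - cos kⱼ)` the dispersion relation (`d ≥ 1`). [folklore] -/
theorem one_sub_symbol (hd : 1 ≤ d) (k : Fin d → ℝ) : 1 - Dhat[d, k] = dispersion k / d := by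
  have hd0 : (d : ℝ) ≠ 0 := by exact_mod_cast (show d ≠ 0 by omega)
  rw [dispersion, Finset.sum_sub_distrib, Finset.sum_const, Finset.card_univ, Fintype.card_fin,
    nsmul_eq_mul, mul_one]
  field_simp

/-- `|D̂(k)| ≤ 1`. [folklore] -/
theorem abs_symbol_le_one (hd : 1 ≤ d) (k : Fin d → ℝ) : |Dhat[d, k]| ≤ 1 := by
  have hd0 : (0 : ℝ) < d := by exact_mod_cast (show 0 < d by omega)
  rw [abs_div, abs_of_pos hd0, div_le_one hd0]
  calc |∑ j : Fin d, Real.cos (k j)| ≤ ∑ j : Fin d, |Real.cos (k j)| := Finset.abs_sum_le_sum_abs _ _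
    _ ≤ ∑ _j : Fin d, (1 : ℝ) := Finset.sum_le_sum fun j _ => Real.abs_cos_le_one _
    _ = d := by simp

/-- `D̂(k) < 1` on the cube away from the origin (`d ≥ 1`). [folklore] -/
theorem symbol_lt_one (hd : 1 ≤ d) {k : Fin d → ℝ} (hk : k ∈ cube d) (hk0 : k ≠ 0) :
    Dhat[d, k] < 1 := by
  have hd0 : (0 : ℝ) < d := by exact_mod_cast (show 0 < d by omega)
  have hε : 0 < dispersion k := dispersion_pos_of_mem_brillouin hk hk0
  have h := one_sub_symbol hd k
  have : 0 < dispersion k / d := div_pos hε hd0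
  linarith

/-- **Uniformly bounded partial sums**: for `d ≥ 3`,
`Σ_{n<M} pₙ(0) ≤ (2π)^{-d} ∫_{[-π,π]^d} 2d/ε(k) dk < ∞`, by the Fourier representation,
`|Σ_{n<M} D̂ⁿ| ≤ 2/(1 - D̂) = 2d/ε` off `k = 0`, and the integrability of `1/ε` in `d ≥ 3`.
[cite: BauerschmidtBrydgesSlade2015LogCorr, Appendix A (proof of Lemma A.1: C₀ finite for d > 2)] -/
theorem sum_range_prob_zero_le (hd : 3 ≤ d) (M : ℕ) :
    ∑ n ∈ Finset.range M, prob[d, n, (0 : Site d)] ≤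
      ((2 * π) ^ d)⁻¹ * ∫ k in cube d, 2 * d / dispersion k := by
  have hd1 : 1 ≤ d := by omega
  have hdpos : (0 : ℝ) < d := by exact_mod_cast (show 0 < d by omega)
  have hπ : (0 : ℝ) < ((2 * π) ^ d)⁻¹ := by positivity
  set F : (Fin d → ℝ) → ℝ := fun k => (∑ n ∈ Finset.range M, (Dhat[d, k]) ^ n) * Real.cos (kdot k (0 : Site d))
    with hF
  have hFint : IntegrableOn F (cube d) volume := by
    refine ContinuousOn.integrableOn_compact (isCompact_univ_pi fun _ => isCompact_Icc) ?_
    exact ((continuous_finsetSum _ fun n _ => continuous_symbol.pow n).mul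
      (Real.continuous_cos.comp (continuous_kdot_left 0))).continuousOn
  have hint : ∀ m : ℕ, IntegrableOn (fun k => (Dhat[d, k]) ^ m * Real.cos (kdot k (0 : Site d))) (cube d) volume :=
    fun m => ContinuousOn.integrableOn_compact (isCompact_univ_pi fun _ => isCompact_Icc)
      ((continuous_symbol.pow m).mul (Real.continuous_cos.comp (continuous_kdot_left 0))).continuousOn
  have hsum : ∑ n ∈ Finset.range M, prob[d, n, (0 : Site d)] = ((2 * π) ^ d)⁻¹ * ∫ k in cube d, F k := by
    simp_rw [prob_eq_integral hd1, ← Finset.mul_sum]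
    congr 1
    rw [← integral_finsetSum _ fun n _ => hint n]
    refine integral_congr_ae (ae_of_all _ fun k => ?_)
    simp only [hF, Finset.sum_mul]
  rw [hsum]
  refine mul_le_mul_of_nonneg_left ?_ hπ.le
  have hG : IntegrableOn (fun k : Fin d → ℝ => 2 * d / dispersion k) (cube d) volume := by
    have h := (integrable_indicator_iff (measurableSet_brillouin d)).1
      (integrable_indicator_inv_dispersion (d := d) hd)
    have h' : IntegrableOn (fun k : Fin d → ℝ => (2 * d : ℝ) * (1 / dispersion k)) (cube d) volume :=
      h.const_mul _
    refine h'.congr_fun (fun k _ => ?_) (measurableSet_brillouin d)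
    show (2 * d : ℝ) * (1 / dispersion k) = 2 * d / dispersion k
    rw [mul_one_div]
  haveI : Nonempty (Fin d) := ⟨⟨0, by omega⟩⟩
  have hae0 : ∀ᵐ k ∂(volume.restrict (cube d)), k ≠ (0 : Fin d → ℝ) := by
    rw [ae_iff]
    have hsub : {k : Fin d → ℝ | ¬k ≠ 0} ⊆ {0} := fun k hk => by simpa using hk
    have hle : (volume.restrict (cube d)) {k : Fin d → ℝ | ¬k ≠ 0} ≤ volume ({0} : Set (Fin d → ℝ)) :=
      (measure_mono hsub).trans (Measure.restrict_apply_le _ _)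
    exact le_antisymm (hle.trans (measure_singleton _).le) bot_le
  have hbound : ∀ᵐ k ∂(volume.restrict (cube d)), ‖F k‖ ≤ 2 * d / dispersion k := by
    filter_upwards [hae0, self_mem_ae_restrict (measurableSet_brillouin d)] with k hk0 hk
    have hlt := symbol_lt_one hd1 hk hk0
    have hge : -1 ≤ Dhat[d, k] := (abs_le.1 (abs_symbol_le_one hd1 k)).1
    have hε : 0 < dispersion k := dispersion_pos_of_mem_brillouin hk hk0
    have h1 : 0 < 1 - Dhat[d, k] := by linarith
    rw [Real.norm_eq_abs, hF]
    simp only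
    rw [abs_mul]
    calc |∑ n ∈ Finset.range M, (Dhat[d, k]) ^ n| * |Real.cos (kdot k (0 : Site d))|
        ≤ 2 / (1 - Dhat[d, k]) * 1 :=
          mul_le_mul (abs_geom_sum_le hge hlt M) (Real.abs_cos_le_one _) (abs_nonneg _)
            (div_nonneg zero_le_two h1.le)
      _ = 2 / (dispersion k / d) := by rw [mul_one, one_sub_symbol hd1]
      _ = 2 * d / dispersion k := by field_simp
  calc ∫ k in cube d, F k ≤ ‖∫ k in cube d, F k‖ := Real.le_norm_self _
    _ ≤ ∫ k in cube d, ‖F k‖ := norm_integral_le_integral_norm _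
    _ ≤ ∫ k in cube d, 2 * d / dispersion k := integral_mono_ae hFint.norm hG hbound

/-- **Transience of simple random walk on `ℤ^d`, `d ≥ 3`**: `Σₙ pₙ(0) < ∞` (the expected number of
returns to the origin is finite). [cite: BauerschmidtBrydgesSlade2015LogCorr, Appendix A (proof of Lemma A.1: C₀(x) finite for d > 2)] -/
theorem summable_prob_zero (hd : 3 ≤ d) : Summable fun n : ℕ => prob[d, n, (0 : Site d)] :=
  summable_of_sum_range_le (fun n => prob_nonneg n 0) fun M => sum_range_prob_zero_le hd M

/-- The Green function at the origin is bounded by the infrared integral: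
`Σₙ pₙ(0) ≤ (2π)^{-d} ∫ 2d/ε(k) dk` (`d ≥ 3`). [folklore] -/
theorem tsum_prob_zero_le (hd : 3 ≤ d) :
    ∑' n : ℕ, prob[d, n, (0 : Site d)] ≤ ((2 * π) ^ d)⁻¹ * ∫ k in cube d, 2 * d / dispersion k :=
  (summable_prob_zero hd).tsum_le_of_sum_range_le fun M => sum_range_prob_zero_le hd M

/-- `p₀(0) = 1`. [folklore] -/
theorem prob_zero_zero : prob[d, 0, (0 : Site d)] = 1 := by
  rw [card_finsetWalkLength_zero, if_pos rfl]
  simp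

/-- The Green function at the origin is at least `1`. [folklore] -/
theorem one_le_tsum_prob_zero (hd : 3 ≤ d) : 1 ≤ ∑' n : ℕ, prob[d, n, (0 : Site d)] := by
  rw [← prob_zero_zero (d := d)]
  exact (summable_prob_zero hd).le_tsum 0 fun n _ => prob_nonneg n 0

end Literature.Barriers.CriticalPhenomena.CTWSAW
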